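import Mathlib
import Literature.Geometry.Kaehler.ComplexTorusRealMultiplicationUnitSignatures
import Literature.AlgebraicGeometry.Motives.WeilDiscriminant
import HarnessLib

/-!
# The arithmetic core (★) of CM-WEIL-SPLIT, elementary: prescribed balanced real signs with
# `(-1)ⁿ · N_{K/ℚ}(f) · d_K` a rational square

Cell `pub-hodgecm2` (COR-CM), binder seat b25 (gen 52), count-neutral own lane CM-WEIL-SPLIT; KERNEL ONLY (theorems;
no definition, no named fact, no `sorry`; `HC_CM` does not occur; nothing here bears on B01 / S2 / the COR-CM chain).

WHAT.  Let `K` be a totally real number field of even degree `[K : ℚ] = 2n` and split its `2n` real embeddings into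
two halves of size `n` (`S` and its complement).  Then there is `f ∈ K` which is NEGATIVE exactly at the embeddings
in `S` and for which

  `(-1)ⁿ · N_{K/ℚ}(f) · d_K = q²`, `q ∈ ℚ^×`

(`d_K = NumberField.discr K`); in particular `(-1)ⁿ N(f) d_K = |N(f)| · d_K` is a norm from EVERY quadratic field.  This is (★) of
`run/shared/lean/pub/pub-hodgecm2/pub-hodgecm2-b25/CM-WEIL-SPLIT.md` §1.3 / addendum (c) and of the module docstring of
`Literature/AlgebraicGeometry/VanGeemen1994/WeilDiscriminantOfCMTypeRealisation.lean` («existence of `f ∈ F⁺` with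
prescribed signs and `N_{F⁺/ℚ}(f) · d_{F⁺} ≡ (-1)ⁿ` — class field theory for `F/F⁺`»), applied to `K = F⁺` and the sign
pattern of a `k`-balanced CM type: it is the arithmetic input making the `k`-hermitian form `Tr_{F/k}(f x ȳ)` of the
polarization `Tr_{F/ℚ}(√-D · f · x · ȳ)` of `A_{(F,Φ)}` SPLIT (discriminant `N_{F⁺/ℚ}(f) · d_{F⁺} ≡ (-1)ⁿ`, van Geemen
LNM 1594 Lemma 5.2; Deligne LNM 900 §5).  The note proved (★) by class field theory (O'Meara 71:19 for `F/F⁺`), which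
is not in Mathlib; THIS FILE GIVES AN ELEMENTARY PROOF, entirely inside Mathlib:

* take a primitive element `α` of `K` whose real conjugates are ORDERED so that the embeddings of `S` and of its
  complement alternate along the real line in the pattern `S, Sᶜ, S, Sᶜ, …` (weak approximation at the infinite places,
  Mathlib `NumberField.InfinitePlace.denseRange_algebraMap_pi`, aimed at the integer targets `2i`, `2i + 1`);
* put `f := P'(α)`, `P` the minimal polynomial of `α`: at a real root the sign of `P'` is `(-1)^{#larger roots}`, so
  `f` is negative exactly on `S` (`prod_sub_neg_of_inl` / `prod_sub_pos_of_inr`, a pairing argument); and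
  `N_{K/ℚ}(P'(α)) = (-1)^{2n(2n-1)/2} · disc(1, α, …, α^{2n-1})` (Mathlib `Algebra.discr_powerBasis_eq_norm`) with
  `disc(1, α, …) = c² · d_K`, `c ∈ ℚ^×` (change of basis to an integral basis), whence
  `(-1)ⁿ N(f) d_K = (c d_K)²`.

So the norm class in (★) is in fact TRIVIAL (a rational square), uniformly in the imaginary quadratic field.

* `prod_sub_neg_of_inl`, `prod_sub_pos_of_inr`, `injective_of_near_targets` — real-line bookkeeping on `Fin n ⊕ Fin n`;
* `exists_forall_abs_sub_lt` — weak approximation at the real embeddings with rational targets (any number field);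
  (`#(K →+* ℝ) = [K : ℚ]` for totally real `K` is REUSED from `Literature/Geometry/Kaehler/ComplexTorusRealMultiplication
  UnitSignatures.lean`, `ComplexTorus.realEmbeddingEquivComplex` / `card_realEmbeddings`, not restated);
* **`exists_sign_and_norm_mul_discr_eq_sq`** — the core, for any splitting `Φ : (K →+* ℝ) ≃ Fin n ⊕ Fin n`;
* **`exists_neg_iff_mem_and_norm_mul_discr_eq_sq`** — the `Finset` form (negative exactly on `S`, `2 · #S = [K:ℚ]`);
* `exists_neg_iff_mem_and_norm_eq_norm_mul_discr` — «`(-1)ⁿ N(f) d_K` is a norm from any quadratic field `L`»;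
* `exists_neg_iff_mem_and_mk_norm_mul_discr_eq` — in the tree's norm-residue vocabulary (`Motives.normUnitsSubgroup`,
  cf. `VanGeemen1994/WeilDiscriminantClass`): the class of `N_{K/ℚ}(f) · d_K` in `ℚˣ ⧸ Nm(Lˣ)` IS the split class `(-1)ⁿ`.

NOT here: the carrier geometry of the note's residuals (a) (freedom of the polarization class) and (b) (Riemann-form
positivity ⇒ sign pattern; the twist as a class) — what still separates `hS` of `CorCM/SimpleCMSixfoldHodgeOfSplitWeilSixfolds`.

## References
* [vanGeemen1994HodgeAV] B. van Geemen, LNM 1594 (1994), Lemma 5.2 (consumer of (★)).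
* [Deligne1982HodgeCycles] P. Deligne, LNM 900 (1982), §5 Prop. 5.1, §5 (c) (the trace-form polarizations `Tr(ξ x ȳ)`).
* [FrohlichTaylor1990] A. Fröhlich, M. J. Taylor, *Algebraic Number Theory*, III (1.4)–(1.6) (`N(f'(α)) = ± disc f`).
-/

noncomputable section

open NumberField NumberField.InfinitePlace Polynomial Module Finset
open Literature.Geometry.Kaehler (ComplexTorus.realEmbeddingEquivComplex ComplexTorus.card_realEmbeddings)

namespace Summit.HodgeConjecture.CorCM.CMWeilSplit

/-! ### §1 Real-line bookkeeping: `2n` reals near the targets `2i` (left half) and `2i+1` (right half) -/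

section RealLine

variable {n : ℕ} (y : Fin n ⊕ Fin n → ℝ)

/-- If `y (inl j)` is within `1/4` of `2j` and `y (inr j)` within `1/4` of `2j + 1` for every `j`, then for each `i`
the product `∏_{z ≠ inl i} (y (inl i) - y z)` is NEGATIVE: the partner `inr i` lies to the right, and every other
pair `{inl j, inr j}` lies entirely on one side of `y (inl i)`. [folklore] -/
theorem prod_sub_neg_of_inl (hl : ∀ j : Fin n, |y (Sum.inl j) - 2 * ((j : ℕ) : ℝ)| < 1 / 4)
    (hr : ∀ j : Fin n, |y (Sum.inr j) - (2 * ((j : ℕ) : ℝ) + 1)| < 1 / 4) (i : Fin n) :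
    ∏ z ∈ univ.erase (Sum.inl i), (y (Sum.inl i) - y z) < 0 := by
  classical
  have bl : ∀ j : Fin n, 2 * ((j : ℕ) : ℝ) - 1 / 4 < y (Sum.inl j) ∧ y (Sum.inl j) < 2 * ((j : ℕ) : ℝ) + 1 / 4 :=
    fun j => by have h := hl j; rw [abs_sub_lt_iff] at h; constructor <;> linarith [h.1, h.2]
  have br : ∀ j : Fin n, 2 * ((j : ℕ) : ℝ) + 1 - 1 / 4 < y (Sum.inr j) ∧
      y (Sum.inr j) < 2 * ((j : ℕ) : ℝ) + 1 + 1 / 4 :=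
    fun j => by have h := hr j; rw [abs_sub_lt_iff] at h; constructor <;> linarith [h.1, h.2]
  set g : Fin n ⊕ Fin n → ℝ := fun z => if z = Sum.inl i then 1 else y (Sum.inl i) - y z with hg
  have h1 : ∏ z ∈ univ.erase (Sum.inl i), (y (Sum.inl i) - y z) = ∏ z, g z := by
    calc ∏ z ∈ univ.erase (Sum.inl i), (y (Sum.inl i) - y z) = ∏ z ∈ univ.erase (Sum.inl i), g z :=
          Finset.prod_congr rfl fun z hz => by simp [hg, (Finset.mem_erase.1 hz).1]
      _ = ∏ z, g z := Finset.prod_erase _ (by simp [hg])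
  have h2 : ∏ z, g z = ∏ j : Fin n, (g (Sum.inl j) * g (Sum.inr j)) := by
    rw [Fintype.prod_sum_type, ← Finset.prod_mul_distrib]
  have h3 : ∀ j : Fin n, j ≠ i → 0 < g (Sum.inl j) * g (Sum.inr j) := by
    intro j hj
    rw [show g (Sum.inl j) = y (Sum.inl i) - y (Sum.inl j) by simp [hg, hj],
      show g (Sum.inr j) = y (Sum.inl i) - y (Sum.inr j) by simp [hg]]
    rcases lt_or_gt_of_ne hj with hlt | hgt
    · -- `j < i`: the pair `j` lies to the left of `y (inl i)`; `i < j`: to the right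
      have hji : ((j : ℕ) : ℝ) + 1 ≤ ((i : ℕ) : ℝ) := by exact_mod_cast (Fin.lt_def.1 hlt)
      exact mul_pos (by linarith [(bl i).1, (bl j).2]) (by linarith [(bl i).1, (br j).2])
    · have hij : ((i : ℕ) : ℝ) + 1 ≤ ((j : ℕ) : ℝ) := by exact_mod_cast (Fin.lt_def.1 hgt)
      exact mul_pos_of_neg_of_neg (by linarith [(bl i).2, (bl j).1]) (by linarith [(bl i).2, (br j).1])
  have h4 : g (Sum.inl i) * g (Sum.inr i) < 0 := by
    rw [show g (Sum.inl i) = 1 by simp [hg], show g (Sum.inr i) = y (Sum.inl i) - y (Sum.inr i) by simp [hg], one_mul]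
    linarith [(bl i).2, (br i).1]
  rw [h1, h2, ← Finset.mul_prod_erase univ _ (Finset.mem_univ i)]
  exact mul_neg_of_neg_of_pos h4 (Finset.prod_pos fun j hj => h3 j (Finset.ne_of_mem_erase hj))

/-- Companion of `prod_sub_neg_of_inl`: for each `i` the product `∏_{z ≠ inr i} (y (inr i) - y z)` is POSITIVE (the
partner `inl i` lies to the left, every other pair on one side). [folklore] -/
theorem prod_sub_pos_of_inr (hl : ∀ j : Fin n, |y (Sum.inl j) - 2 * ((j : ℕ) : ℝ)| < 1 / 4)
    (hr : ∀ j : Fin n, |y (Sum.inr j) - (2 * ((j : ℕ) : ℝ) + 1)| < 1 / 4) (i : Fin n) :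
    0 < ∏ z ∈ univ.erase (Sum.inr i), (y (Sum.inr i) - y z) := by
  classical
  have bl : ∀ j : Fin n, 2 * ((j : ℕ) : ℝ) - 1 / 4 < y (Sum.inl j) ∧ y (Sum.inl j) < 2 * ((j : ℕ) : ℝ) + 1 / 4 :=
    fun j => by have h := hl j; rw [abs_sub_lt_iff] at h; constructor <;> linarith [h.1, h.2]
  have br : ∀ j : Fin n, 2 * ((j : ℕ) : ℝ) + 1 - 1 / 4 < y (Sum.inr j) ∧
      y (Sum.inr j) < 2 * ((j : ℕ) : ℝ) + 1 + 1 / 4 :=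
    fun j => by have h := hr j; rw [abs_sub_lt_iff] at h; constructor <;> linarith [h.1, h.2]
  set g : Fin n ⊕ Fin n → ℝ := fun z => if z = Sum.inr i then 1 else y (Sum.inr i) - y z with hg
  have h1 : ∏ z ∈ univ.erase (Sum.inr i), (y (Sum.inr i) - y z) = ∏ z, g z := by
    calc ∏ z ∈ univ.erase (Sum.inr i), (y (Sum.inr i) - y z) = ∏ z ∈ univ.erase (Sum.inr i), g z :=
          Finset.prod_congr rfl fun z hz => by simp [hg, (Finset.mem_erase.1 hz).1]
      _ = ∏ z, g z := Finset.prod_erase _ (by simp [hg])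
  have h2 : ∏ z, g z = ∏ j : Fin n, (g (Sum.inl j) * g (Sum.inr j)) := by
    rw [Fintype.prod_sum_type, ← Finset.prod_mul_distrib]
  have h3 : ∀ j : Fin n, 0 < g (Sum.inl j) * g (Sum.inr j) := by
    intro j
    by_cases hj : j = i
    · subst hj
      rw [show g (Sum.inl j) = y (Sum.inr j) - y (Sum.inl j) by simp [hg], show g (Sum.inr j) = 1 by simp [hg], mul_one]
      linarith [(bl j).2, (br j).1]
    · rw [show g (Sum.inl j) = y (Sum.inr i) - y (Sum.inl j) by simp [hg],
        show g (Sum.inr j) = y (Sum.inr i) - y (Sum.inr j) by simp [hg, hj]]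
      rcases lt_or_gt_of_ne hj with hlt | hgt
      · have hji : ((j : ℕ) : ℝ) + 1 ≤ ((i : ℕ) : ℝ) := by exact_mod_cast (Fin.lt_def.1 hlt)
        exact mul_pos (by linarith [(br i).1, (bl j).2]) (by linarith [(br i).1, (br j).2])
      · have hij : ((i : ℕ) : ℝ) + 1 ≤ ((j : ℕ) : ℝ) := by exact_mod_cast (Fin.lt_def.1 hgt)
        exact mul_pos_of_neg_of_neg (by linarith [(br i).2, (bl j).1]) (by linarith [(br i).2, (br j).1])
  rw [h1, h2]
  exact Finset.prod_pos fun j _ => h3 j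

/-- Reals near the targets `2i`, `2i + 1` as above are pairwise distinct. [folklore] -/
theorem injective_of_near_targets (hl : ∀ j : Fin n, |y (Sum.inl j) - 2 * ((j : ℕ) : ℝ)| < 1 / 4)
    (hr : ∀ j : Fin n, |y (Sum.inr j) - (2 * ((j : ℕ) : ℝ) + 1)| < 1 / 4) : Function.Injective y := by
  classical
  intro z₁ z₂ h
  by_contra hne
  have key : ∏ z ∈ univ.erase z₁, (y z₁ - y z) ≠ 0 := by
    cases z₁ with
    | inl i => exact (prod_sub_neg_of_inl y hl hr i).ne
    | inr i => exact (prod_sub_pos_of_inr y hl hr i).ne'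
  exact key (Finset.prod_eq_zero (Finset.mem_erase.2 ⟨Ne.symm hne, Finset.mem_univ z₂⟩) (by rw [h, sub_self]))

end RealLine

/-! ### §2 Weak approximation at the real embeddings, rational targets -/

section WeakApproximation

variable (K : Type*) [Field K] [NumberField K]

/-- **Weak approximation at the real embeddings** (any number field): for rational targets `t σ` and `ε > 0` there is
`α ∈ K` with `|σ α - t σ| < ε` at every real embedding `σ : K →+* ℝ` (Mathlib's
`NumberField.InfinitePlace.denseRange_algebraMap_pi`, read at the real places). [folklore] -/
theorem exists_forall_abs_sub_lt (t : (K →+* ℝ) → ℚ) {ε : ℝ} (hε : 0 < ε) :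
    ∃ α : K, ∀ σ : K →+* ℝ, |σ α - t σ| < ε := by
  classical
  let t' : InfinitePlace K → K := fun v => if hv : v.IsReal then ((t (embedding_of_isReal hv) : ℚ) : K) else 0
  let T : (v : InfinitePlace K) → WithAbs v.1 := fun v => algebraMap K (WithAbs v.1) (t' v)
  obtain ⟨α, hα⟩ := Metric.denseRange_iff.1 (denseRange_algebraMap_pi K) T ε hε
  refine ⟨α, fun σ => ?_⟩
  set φ : K →+* ℂ := Complex.ofRealHom.comp σ with hφdef
  have hφ : ComplexEmbedding.IsReal φ := by
    rw [ComplexEmbedding.isReal_iff]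
    ext x
    simp [hφdef, ComplexEmbedding.conjugate_coe_eq]
  set v : InfinitePlace K := InfinitePlace.mk φ with hvdef
  have hv : v.IsReal := ⟨φ, hφ, rfl⟩
  have hemb : embedding_of_isReal hv = σ := by
    ext x
    apply Complex.ofReal_injective
    rw [embedding_of_isReal_apply, hvdef, embedding_mk_eq_of_isReal hφ]
    rfl
  have hT : t' v = ((t σ : ℚ) : K) := by simp only [t', dif_pos hv, hemb]
  have h1 := (dist_pi_lt_iff hε).1 hα v
  rw [Pi.algebraMap_apply, dist_eq_norm] at h1
  have h2 : ‖T v - algebraMap K (WithAbs v.1) α‖ = |σ α - t σ| := by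
    simp only [T]
    rw [← map_sub, WithAbs.algebraMap_right_apply, WithAbs.norm_toAbs_eq, Algebra.algebraMap_self,
      RingHom.id_apply, hT]
    change v _ = _
    rw [hvdef, InfinitePlace.apply, hφdef, RingHom.comp_apply, Complex.ofRealHom_eq_coe, Complex.norm_real,
      Real.norm_eq_abs, map_sub, map_ratCast, abs_sub_comm]
  rw [h2] at h1
  exact h1

end WeakApproximation

/-! ### §3 The core: totally real `K`, `[K : ℚ] = 2n` -/

section Core

variable (K : Type*) [Field K] [NumberField K] [IsTotallyReal K]

/-- `(-1)^{2n(2n-1)/2} = (-1)ⁿ`. [folklore] -/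
theorem neg_one_pow_two_mul_mul_pred_div_two (n : ℕ) : (-1 : ℚ) ^ (2 * n * (2 * n - 1) / 2) = (-1) ^ n := by
  have h : 2 * n * (2 * n - 1) / 2 = n * (2 * n - 1) := by
    rw [mul_assoc, Nat.mul_div_cancel_left _ two_pos]
  rw [h]
  rcases Nat.even_or_odd n with he | ho
  · rw [Even.neg_one_pow he, Even.neg_one_pow (he.mul_right _)]
  · have h1 : Odd (2 * n - 1) := ⟨n - 1, by obtain ⟨k, hk⟩ := ho; omega⟩
    rw [Odd.neg_one_pow ho, Odd.neg_one_pow (ho.mul h1)]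

/-- **The arithmetic core (★), elementary form.**  Let `K` be a totally real number field whose real embeddings are
split into two halves by `Φ : (K →+* ℝ) ≃ Fin n ⊕ Fin n` (so `[K : ℚ] = 2n`).  Then there is `f ∈ K`, negative at
every embedding of the left half and positive at every embedding of the right half, with
`(-1)ⁿ · N_{K/ℚ}(f) · d_K = q²` for a non-zero rational `q` (`d_K = NumberField.discr K`).  Proof: `f = P'(α)` for a
primitive `α` whose conjugates alternate left/right along `ℝ` (weak approximation); `N(P'(α)) = ± disc(P)` and
`disc(P) = c² d_K`. [folklore] -/
theorem exists_sign_and_norm_mul_discr_eq_sq {n : ℕ} (Φ : (K →+* ℝ) ≃ Fin n ⊕ Fin n) :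
    ∃ f : K, (∀ i : Fin n, (Φ.symm (Sum.inl i)) f < 0) ∧ (∀ i : Fin n, 0 < (Φ.symm (Sum.inr i)) f) ∧
      ∃ q : ℚ, q ≠ 0 ∧ (-1 : ℚ) ^ n * Algebra.norm ℚ f * (NumberField.discr K : ℚ) = q ^ 2 := by
  classical
  -- (1) a primitive element with alternating conjugates
  let t : (K →+* ℝ) → ℚ := fun σ =>
    Sum.elim (fun i : Fin n => (2 * (i : ℕ) : ℚ)) (fun i : Fin n => (2 * (i : ℕ) + 1 : ℚ)) (Φ σ)
  obtain ⟨α, hα⟩ := exists_forall_abs_sub_lt K t (by norm_num : (0 : ℝ) < 1 / 4)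
  let y : Fin n ⊕ Fin n → ℝ := fun z => (Φ.symm z) α
  have hl : ∀ j : Fin n, |y (Sum.inl j) - 2 * ((j : ℕ) : ℝ)| < 1 / 4 := fun j => by
    have h := hα (Φ.symm (Sum.inl j))
    simpa [y, t] using h
  have hr : ∀ j : Fin n, |y (Sum.inr j) - (2 * ((j : ℕ) : ℝ) + 1)| < 1 / 4 := fun j => by
    have h := hα (Φ.symm (Sum.inr j))
    simpa [y, t] using h
  have hinj : Function.Injective fun σ : K →+* ℝ => σ α := by
    intro σ τ h
    have h' : y (Φ σ) = y (Φ τ) := by simpa [y] using h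
    exact Φ.injective (injective_of_near_targets y hl hr h')
  -- cardinalities
  have hcardR : Fintype.card (K →+* ℝ) = 2 * n := by
    rw [Fintype.card_congr Φ, Fintype.card_sum, Fintype.card_fin]; ring
  have hfin : finrank ℚ K = 2 * n := by rw [← hcardR, ComplexTorus.card_realEmbeddings]
  -- (2) `α` is a primitive element
  have hαi : IsIntegral ℚ α := IsIntegral.of_finite ℚ α
  have htop : IntermediateField.adjoin ℚ {α} = ⊤ := by
    rw [Field.primitive_element_iff_algHom_eq_of_eval' ℚ ℂ (fun x => IsAlgClosed.splits _) α]
    intro ψ₁ ψ₂ h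
    -- every complex embedding of the totally real `K` is a real one (`ComplexTorus.realEmbeddingEquivComplex`)
    set e : (K →+* ℝ) ≃ (K →+* ℂ) := ComplexTorus.realEmbeddingEquivComplex with hedef
    have h1 : ∀ ψ : K →ₐ[ℚ] ℂ, (((e.symm (ψ : K →+* ℂ)) α : ℝ) : ℂ) = ψ α :=
      fun ψ => ComplexEmbedding.IsReal.coe_embedding_apply (IsTotallyReal.complexEmbedding_isReal (ψ : K →+* ℂ)) α
    have h2 : e.symm (ψ₁ : K →+* ℂ) α = e.symm (ψ₂ : K →+* ℂ) α := by
      apply Complex.ofReal_injective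
      rw [h1, h1]
      exact h
    have h3 := e.symm.injective (hinj h2)
    exact AlgHom.coe_ringHom_injective h3
  have htop' : Algebra.adjoin ℚ {α} = ⊤ := by
    rw [← IntermediateField.adjoin_simple_toSubalgebra_of_isAlgebraic hαi.isAlgebraic, htop,
      IntermediateField.top_toSubalgebra]
  let pb : PowerBasis ℚ K := PowerBasis.ofAdjoinEqTop hαi htop'
  have hgen : pb.gen = α := PowerBasis.ofAdjoinEqTop_gen hαi htop'
  -- (3) the element
  set P : ℚ[X] := minpoly ℚ α with hPdef
  set f : K := aeval α (derivative P) with hfdef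
  -- (4) the real factorisation of `P` and the sign of `σ f`
  have hdeg : P.natDegree = 2 * n := by
    rw [hPdef, (Field.primitive_element_iff_minpoly_natDegree_eq ℚ α).1 htop, hfin]
  have hPR : P.map (algebraMap ℚ ℝ) = ∏ τ : K →+* ℝ, (X - C (τ α)) := by
    have hQm : (∏ τ : K →+* ℝ, (X - C (τ α))).Monic := monic_prod_of_monic _ _ fun τ _ => monic_X_sub_C (τ α)
    have hPm : (P.map (algebraMap ℚ ℝ)).Monic := (minpoly.monic hαi).map _
    have hdvd : (∏ τ : K →+* ℝ, (X - C (τ α))) ∣ P.map (algebraMap ℚ ℝ) := by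
      apply Finset.prod_dvd_of_coprime ((pairwise_coprime_X_sub_C hinj).set_pairwise _)
      intro τ _
      rw [dvd_iff_isRoot, IsRoot.def, eval_map, ← aeval_def, hPdef]
      have := Polynomial.aeval_algHom_apply (τ.toRatAlgHom) α (minpoly ℚ α)
      rw [minpoly.aeval, map_zero] at this
      simpa using this
    refine eq_of_monic_of_dvd_of_natDegree_le hQm hPm hdvd ?_
    rw [natDegree_map, hdeg, natDegree_finsetProd_X_sub_C_eq_card, Finset.card_univ, hcardR]
  have hσf : ∀ σ : K →+* ℝ, σ f = ∏ τ ∈ univ.erase σ, (σ α - τ α) := by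
    intro σ
    have h1 : σ f = eval (σ α) (derivative (P.map (algebraMap ℚ ℝ))) := by
      rw [derivative_map, eval_map, ← aeval_def, hfdef]
      have := Polynomial.aeval_algHom_apply (σ.toRatAlgHom) α (derivative P)
      simpa using this.symm
    rw [h1, hPR]
    have h2 : (∏ τ : K →+* ℝ, (X - C (τ α))) =
        (Multiset.map (fun a : ℝ => X - C a) (univ.val.map fun τ : K →+* ℝ => τ α)).prod := by
      rw [Multiset.map_map]; rfl
    rw [h2, eval_multiset_prod_X_sub_C_derivative
      (Multiset.mem_map_of_mem (fun τ : K →+* ℝ => τ α) (Finset.mem_univ σ)),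
      ← Multiset.map_erase _ hinj, ← Finset.erase_val, Multiset.map_map]
    rfl
  have htrans : ∀ σ : K →+* ℝ,
      ∏ τ ∈ univ.erase σ, (σ α - τ α) = ∏ z ∈ univ.erase (Φ σ), (y (Φ σ) - y z) := by
    intro σ
    refine Finset.prod_equiv Φ (fun τ => ?_) (fun τ _ => ?_)
    · simp
    · simp [y]
  refine ⟨f, fun i => ?_, fun i => ?_, ?_⟩
  · rw [hσf, htrans, Equiv.apply_symm_apply]
    have := prod_sub_neg_of_inl y hl hr i
    simpa [y] using this
  · rw [hσf, htrans, Equiv.apply_symm_apply]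
    have := prod_sub_pos_of_inr y hl hr i
    simpa [y] using this
  -- (5) the discriminant identity
  have hdiscr : Algebra.discr ℚ pb.basis = (-1 : ℚ) ^ n * Algebra.norm ℚ f := by
    rw [Algebra.discr_powerBasis_eq_norm, hgen, hfin, neg_one_pow_two_mul_mul_pred_div_two]
  let b₀ := NumberField.integralBasis K
  let e := b₀.indexEquiv pb.basis
  set c : ℚ := ((b₀.reindex e).toMatrix pb.basis).det with hcdef
  have hkey : Algebra.discr ℚ pb.basis = c ^ 2 * (NumberField.discr K : ℚ) := by
    have h := Algebra.discr_of_matrix_vecMul (⇑(b₀.reindex e)) ((b₀.reindex e).toMatrix pb.basis)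
    rw [Basis.toMatrix_map_vecMul, Basis.coe_reindex, Algebra.discr_reindex] at h
    rw [h, NumberField.coe_discr]
  have hd : (NumberField.discr K : ℚ) ≠ 0 := Int.cast_ne_zero.2 (NumberField.discr_ne_zero K)
  have hc : c ≠ 0 := by
    intro hc0
    apply Algebra.discr_not_zero_of_basis ℚ pb.basis
    rw [hkey, hc0]
    ring
  refine ⟨c * (NumberField.discr K : ℚ), mul_ne_zero hc hd, ?_⟩
  rw [← hdiscr, hkey]
  ring

/-- **(★) in `Finset` form.**  For a totally real number field `K` and a set `S` of real embeddings with
`2 · #S = [K : ℚ]`, there is `f ∈ K` NEGATIVE EXACTLY at the embeddings in `S`, with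
`(-1)^{#S} · N_{K/ℚ}(f) · d_K` the square of a non-zero rational.  (With `K = F⁺` the maximal real subfield of a CM
field `F ⊇ k = ℚ(√-D)` and `S` the sign pattern of a `k`-balanced CM type, this is the arithmetic core of the
splitness of `(A_{(F,Φ)}, k, Tr_{F/ℚ}(√-D f x ȳ))`, van Geemen LNM 1594 Lemma 5.2.) [folklore] -/
theorem exists_neg_iff_mem_and_norm_mul_discr_eq_sq (S : Finset (K →+* ℝ)) (hS : 2 * S.card = finrank ℚ K) :
    ∃ f : K, (∀ σ : K →+* ℝ, σ f < 0 ↔ σ ∈ S) ∧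
      ∃ q : ℚ, q ≠ 0 ∧ (-1 : ℚ) ^ S.card * Algebra.norm ℚ f * (NumberField.discr K : ℚ) = q ^ 2 := by
  classical
  have hcard : Fintype.card (K →+* ℝ) = finrank ℚ K := ComplexTorus.card_realEmbeddings
  set n := S.card with hn
  let eS : {σ : K →+* ℝ // σ ∈ S} ≃ Fin n := Fintype.equivFinOfCardEq (Fintype.card_coe S)
  let eT : {σ : K →+* ℝ // σ ∉ S} ≃ Fin n :=
    Fintype.equivFinOfCardEq (by rw [Fintype.card_subtype_compl, Fintype.card_coe, hcard]; omega)
  let Φ : (K →+* ℝ) ≃ Fin n ⊕ Fin n := (Equiv.sumCompl fun σ : K →+* ℝ => σ ∈ S).symm.trans (eS.sumCongr eT)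
  obtain ⟨f, hneg, hpos, q, hq, hsq⟩ := exists_sign_and_norm_mul_discr_eq_sq K Φ
  refine ⟨f, fun σ => ?_, q, hq, hsq⟩
  by_cases hσ : σ ∈ S
  · have hΦ : Φ σ = Sum.inl (eS ⟨σ, hσ⟩) := by
      simp [Φ, Equiv.sumCompl_symm_apply_of_pos hσ]
    have hσ' : σ = Φ.symm (Sum.inl (eS ⟨σ, hσ⟩)) := by rw [← hΦ, Equiv.symm_apply_apply]
    exact ⟨fun _ => hσ, fun _ => hσ' ▸ hneg _⟩
  · have hΦ : Φ σ = Sum.inr (eT ⟨σ, hσ⟩) := by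
      simp [Φ, Equiv.sumCompl_symm_apply_of_neg hσ]
    have hσ' : σ = Φ.symm (Sum.inr (eT ⟨σ, hσ⟩)) := by rw [← hΦ, Equiv.symm_apply_apply]
    exact ⟨fun h => (lt_asymm h (hσ' ▸ hpos (eT ⟨σ, hσ⟩))).elim, fun h => (hσ h).elim⟩

/-- **(★) as printed: `(-1)ⁿ N_{K/ℚ}(f) d_K` is a norm from any quadratic field.**  For `S` as above and any
quadratic extension `L/ℚ` (e.g. `L = ℚ(√-D)`), there is `f ∈ K` negative exactly on `S` and a non-zero `z ∈ L` with
`N_{L/ℚ}(z) = (-1)^{#S} · N_{K/ℚ}(f) · d_K` (namely `z = q ∈ ℚ`). [folklore] -/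
theorem exists_neg_iff_mem_and_norm_eq_norm_mul_discr (S : Finset (K →+* ℝ)) (hS : 2 * S.card = finrank ℚ K)
    (L : Type*) [Field L] [Algebra ℚ L] (hL : finrank ℚ L = 2) :
    ∃ f : K, (∀ σ : K →+* ℝ, σ f < 0 ↔ σ ∈ S) ∧
      ∃ z : L, z ≠ 0 ∧ Algebra.norm ℚ z = (-1 : ℚ) ^ S.card * Algebra.norm ℚ f * (NumberField.discr K : ℚ) := by
  obtain ⟨f, hf, q, hq, hsq⟩ := exists_neg_iff_mem_and_norm_mul_discr_eq_sq K S hS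
  refine ⟨f, hf, algebraMap ℚ L q, ?_, ?_⟩
  · have : Nontrivial L := inferInstance
    exact (map_ne_zero_iff _ (algebraMap ℚ L).injective).2 hq
  · rw [Algebra.norm_algebraMap, hL, hsq]

/-- **(★) in the tree's norm-residue vocabulary: the class of `N_{K/ℚ}(f) · d_K` in `ℚˣ ⧸ Nm(Lˣ)` is the SPLIT class
`(-1)ⁿ`.**  For `S` as above and any quadratic `ℚ`-algebra `L` (e.g. `VanGeemen1994.weilField d = ℚ[X]/(X² + d)`, whose
`ℚˣ ⧸ Motives.normUnitsSubgroup ℚ (weilField d)` is `weilNormResidueGroup d`), there is `f ∈ K` negative exactly on `S`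
with `N_{K/ℚ}(f) · d_K ≠ 0` and `[N_{K/ℚ}(f) · d_K] = [(-1)^{#S}]` — the value of `splitDiscriminantClass n d` in the ring-2
ladder (van Geemen 5.4 / (5.4.1): `det H = (-1)ⁿ` is the hyperbolic class). [folklore] -/
theorem exists_neg_iff_mem_and_mk_norm_mul_discr_eq (S : Finset (K →+* ℝ)) (hS : 2 * S.card = finrank ℚ K)
    (L : Type*) [Ring L] [Algebra ℚ L] (hL : finrank ℚ L = 2) :
    ∃ f : K, (∀ σ : K →+* ℝ, σ f < 0 ↔ σ ∈ S) ∧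
      ∃ hf : Algebra.norm ℚ f * (NumberField.discr K : ℚ) ≠ 0,
        (QuotientGroup.mk (Units.mk0 _ hf) : ℚˣ ⧸ Literature.AlgebraicGeometry.Motives.normUnitsSubgroup ℚ L) =
          QuotientGroup.mk ((-1 : ℚˣ) ^ S.card) := by
  obtain ⟨f, hf, q, hq, hsq⟩ := exists_neg_iff_mem_and_norm_mul_discr_eq_sq K S hS
  have hNd : Algebra.norm ℚ f * (NumberField.discr K : ℚ) ≠ 0 := fun h0 =>
    hq ((pow_eq_zero_iff two_ne_zero).1 (by rw [← hsq, mul_assoc, h0, mul_zero]))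
  refine ⟨f, hf, hNd, ?_⟩
  rw [QuotientGroup.eq]
  have hw : (Units.mk0 _ hNd)⁻¹ * (-1 : ℚˣ) ^ S.card = (Units.mk0 q hq * (Units.mk0 _ hNd)⁻¹) ^ finrank ℚ L := by
    rw [hL, Units.ext_iff]
    simp only [Units.val_mul, Units.val_pow_eq_pow_val, Units.val_inv_eq_inv_val, Units.val_mk0, Units.val_neg,
      Units.val_one, mul_pow, ← hsq]
    field_simp
  rw [hw]
  exact Literature.AlgebraicGeometry.Motives.pow_finrank_mem_normUnitsSubgroup _

end Core

end Summit.HodgeConjecture.CorCM.CMWeilSplit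

end
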